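import Mathlib.Tactic
import HarnessLib

/-!
# Kozma–Nitzan's Question 8 at three relays — the prefix decomposition behind DICHOTOMY D (gen 27)

Support file (`--supports stmt-CriticalPhenomena-4575`, closed crux; independent mathematics on Kozma–Nitzan's Question 8,
arXiv:2401.12397 §5.5 p. 36), prover `prim-ineq-gen-6` (gen 27).  No definitions, no named facts, no sorries; standard axioms.
Memo `run/shared/lean/prim/prim-ineq-gen-6/FINDING-G27.md` §2.

For a path-end block the mass ratio of a class-`k` child of a class-`v` node is `r_{k,v} = ρ_k·M(A_[k+1,v],C_[k+1,v])·p_v/p_k` with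
`M(a,c) = a + c − ac`.  The prefix sums `F_s(v) := Σ_{k<s} r_{k,v}δ_k` of the children's subtree sums therefore satisfy, by the
multilinearity of `M` in the marks of the segment `[s+1,v]` (`M_multilinear`), the exact decomposition
`F_s(v)/p_v = a′c′·Q_s + a′(1−c′)·X_s + c′(1−a′)·Y_s` with `(a′,c′) = (A_[s+1,v],C_[s+1,v])`, `Q_s = F_s(s)/p_s`,
`X_s = Σ_{k<s}ρ_kA_[k+1,s]δ_k/p_k`, `Y_s = Σ_{k<s}ρ_kC_[k+1,s]δ_k/p_k` (memo §2(b)).  Hence the corner signs decide the sign of every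
extension (`interp_nonpos_of_corners`), which is the step (X1) ⟹ (S1); and (S1) gives DICHOTOMY D through the smallest importer child
(`sigma_nonpos_of_prefix`, memo §2(a)).  The corner inequality itself — conjecture (UNI) of the memo, `p_tX_t ≤ (δ_t−β_t)⁺` — is open.
[cite: KozmaNitzan2024, Question 8 (§5.5 p. 36)]
-/

namespace Summit.CriticalPhenomena.PercolationContinuityZ3.Theorems

namespace PocketCert

/-- **Multilinearity of the fragment factor.**  `M(αa′, κc′) = a′c′·M(α,κ) + a′(1−c′)·α + c′(1−a′)·κ` for `M(x,y) = x + y − xy`: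
splitting the segment `[k+1,v] = [k+1,s] ∪ [s+1,v]` expresses the child ratio at `v` through the three corner weights at `s`
(both marks kept / C killed / A killed). [cite: KozmaNitzan2024, Question 8 (§5.5 p. 36)] -/
theorem M_multilinear (α κ a c : ℝ) :
    (α * a) + (κ * c) - (α * a) * (κ * c) = a * c * (α + κ - α * κ) + a * (1 - c) * α + c * (1 - a) * κ := by
  ring

/-- **Corner signs decide every extension ((X1) ⟹ (S1)).**  If the three corner values are nonpositive, `Q ≤ 0`, `X ≤ 0`, `Y ≤ 0`,
then for all segment marks `a′, c′ ∈ [0,1]` the interpolated prefix sum `a′c′Q + a′(1−c′)X + c′(1−a′)Y` is nonpositive.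
[cite: KozmaNitzan2024, Question 8 (§5.5 p. 36)] -/
theorem interp_nonpos_of_corners (Q X Y a c : ℝ) (hQ : Q ≤ 0) (hX : X ≤ 0) (hY : Y ≤ 0) (ha0 : 0 ≤ a) (ha1 : a ≤ 1)
    (hc0 : 0 ≤ c) (hc1 : c ≤ 1) : a * c * Q + a * (1 - c) * X + c * (1 - a) * Y ≤ 0 := by
  have h1 : a * c * Q ≤ 0 := mul_nonpos_of_nonneg_of_nonpos (mul_nonneg ha0 hc0) hQ
  have h2 : a * (1 - c) * X ≤ 0 := mul_nonpos_of_nonneg_of_nonpos (mul_nonneg ha0 (sub_nonneg.2 hc1)) hX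
  have h3 : c * (1 - a) * Y ≤ 0 := mul_nonpos_of_nonneg_of_nonpos (mul_nonneg hc0 (sub_nonneg.2 ha1)) hY
  linarith

/-- **The importer corner from (UNI).**  At a node with `p·X ≤ (δ − β)⁺` (conjecture (UNI) of the memo) which is an importer
(`δ < β`), the A-connected children sum is nonpositive: `X ≤ 0` (`p > 0`). [cite: KozmaNitzan2024, Question 8 (§5.5 p. 36)] -/
theorem corner_nonpos_of_UNI (p X δ β : ℝ) (hp : 0 < p) (hUNI : p * X ≤ max (δ - β) 0) (himp : δ < β) : X ≤ 0 := by
  have h : max (δ - β) 0 = 0 := max_eq_right (by linarith)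
  rw [h] at hUNI
  by_contra hX
  have : 0 < p * X := mul_pos hp (not_le.mp hX)
  linarith

/-- **DICHOTOMY D from the prefix sign ((S1) ⟹ D).**  At a node `k` whose smallest importer child is `k*`, the stranded surplus
satisfies `σ_k ≤ F_{k*}(k) − r_{k*,k}|β_{k*}|` (children before `k*` report `δ`, the importer reports `β_{k*}`, later children report
nonpositive amounts); so `F_{k*}(k) ≤ 0` and `r_{k*,k}|β_{k*}| ≥ 0` force `σ_k ≤ 0` — no node with an importer child strands surplus.
[cite: KozmaNitzan2024, Question 8 (§5.5 p. 36)] -/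
theorem sigma_nonpos_of_prefix (σ F r b tail : ℝ) (hσ : σ = F - r * b + tail) (hF : F ≤ 0) (hr : 0 ≤ r) (hb : 0 ≤ b)
    (htail : tail ≤ 0) : σ ≤ 0 := by
  have : 0 ≤ r * b := mul_nonneg hr hb
  linarith

end PocketCert

end Summit.CriticalPhenomena.PercolationContinuityZ3.Theorems
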